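import Mathlib

/-!
# Sequential local limits are uniform on compact sets
# (helper for `DensityIntegration`, item stmt-CriticalPhenomena-14890, route CardyBoundaryCoulombGas)

The engine crux `BoundaryDefectGaussianR` is a *sequential, pointwise* statement: for every
sequence of lattice marks converging to a boundary point the normalised partition function
converges. Integrating the mark density needs the *uniform* version on compact flat pieces of
the boundary. This file proves the abstract upgrade: if stage-`n` samples `q ∈ A n` carry
positions `e n q` in a metric space and values `f n q ∈ ℝ`, and along EVERY subsequence of stages
and every choice of samples whose positions converge to a point `x` of a compact set `K` the
values converge to `F x` (`F` continuous on `K`), then eventually every sample within distance `r`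
of a point `x ∈ K` has value within `ε` of `F x`. (Contradiction + sequential compactness.)
-/

noncomputable section

open Set Filter Topology Metric

namespace Summit.CriticalPhenomena.CardyFormulaZ2.Theorems

/-- **Sequential local limits are uniform on compacts.** See the module docstring. The
subsequence `φ` in the hypothesis is essential (the conclusion is about all large stages); in the
application the engine crux is simply applied along the mesh subsequence `δ ∘ φ`. [folklore] -/
theorem eventually_forall_abs_sub_lt_of_seq_tendsto {X α : Type*} [PseudoMetricSpace X]
    {K : Set X} (hK : IsCompact K) {F : X → ℝ} (hF : ContinuousOn F K)
    (A : ℕ → Set α) (e : ℕ → α → X) (f : ℕ → α → ℝ)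
    (hseq : ∀ x ∈ K, ∀ (φ : ℕ → ℕ) (q : ℕ → α), StrictMono φ → (∀ i, q i ∈ A (φ i)) →
      Tendsto (fun i ↦ e (φ i) (q i)) atTop (𝓝 x) → Tendsto (fun i ↦ f (φ i) (q i)) atTop (𝓝 (F x)))
    (ε : ℝ) (hε : 0 < ε) :
    ∃ r > 0, ∀ᶠ n in atTop, ∀ q ∈ A n, ∀ x ∈ K, dist (e n q) x < r → |f n q - F x| < ε := by
  by_contra hcon
  push Not at hcon
  -- for `r = 1/(j+1)` the failure is frequent in `n`
  have hfreq : ∀ j : ℕ, ∃ᶠ n in atTop, ∃ q ∈ A n, ∃ x ∈ K,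
      dist (e n q) x < 1 / ((j : ℝ) + 1) ∧ ε ≤ |f n q - F x| :=
    fun j ↦ hcon (1 / ((j : ℝ) + 1)) (by positivity)
  obtain ⟨φ, hφ, hP⟩ := extraction_forall_of_frequently hfreq
  choose q hqA x hxK hdist hbad using hP
  -- extract a convergent subsequence of the points `x j ∈ K`
  obtain ⟨x₀, hx₀K, ψ, hψ, hxlim⟩ := hK.tendsto_subseq hxK
  -- positions along `φ ∘ ψ` converge to `x₀`
  have hpos : Tendsto (fun i ↦ e (φ (ψ i)) (q (ψ i))) atTop (𝓝 x₀) := by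
    rw [tendsto_iff_dist_tendsto_zero]
    have h1 : Tendsto (fun i ↦ dist (x (ψ i)) x₀) atTop (𝓝 0) :=
      (tendsto_iff_dist_tendsto_zero.1 hxlim)
    have h2 : Tendsto (fun i : ℕ ↦ 1 / ((ψ i : ℝ) + 1)) atTop (𝓝 0) :=
      tendsto_one_div_add_atTop_nhds_zero_nat.comp hψ.tendsto_atTop
    refine squeeze_zero (g := fun i ↦ 1 / ((ψ i : ℝ) + 1) + dist (x (ψ i)) x₀)
      (fun i ↦ dist_nonneg) (fun i ↦ ?_) (by simpa using h2.add h1)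
    exact (dist_triangle _ (x (ψ i)) _).trans (add_le_add (hdist (ψ i)).le le_rfl)
  have hval := hseq x₀ hx₀K (φ ∘ ψ) (q ∘ ψ) (hφ.comp hψ) (fun i ↦ hqA (ψ i)) hpos
  -- `F (x (ψ i)) → F x₀` by continuity on `K`
  have hFx : Tendsto (fun i ↦ F (x (ψ i))) atTop (𝓝 (F x₀)) :=
    (hF x₀ hx₀K).tendsto.comp (tendsto_nhdsWithin_iff.2 ⟨hxlim, Eventually.of_forall fun i ↦ hxK _⟩)
  have hdiff : Tendsto (fun i ↦ f (φ (ψ i)) (q (ψ i)) - F (x (ψ i))) atTop (𝓝 0) := by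
    simpa using hval.sub hFx
  have hsmall := (Metric.tendsto_nhds.1 hdiff) ε hε
  obtain ⟨i, hi⟩ := hsmall.exists
  rw [Real.dist_0_eq_abs] at hi
  exact (lt_irrefl ε) ((hbad (ψ i)).trans_lt hi)

end Summit.CriticalPhenomena.CardyFormulaZ2.Theorems

end
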